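import Summits.QuantumAdvantage.QuantumAdvantage.Theses.CompactnessLift
import Literature.Computability.QuantumComplexity.BQTime

/-!
# Route CompactnessLift · support `QuadSubsetBQP` (item stmt-QuantumAdvantage-15275): `QuadQ ⊆ BQP`

The route's inlined class `QuadQ` — languages decided with error `≤ 1/3` by oracle-free Clifford+T
circuit families whose sigma-encoded description `1ⁿ ↦ ⟨Qₙ⟩` is computable within `C * n ^ 2 + C`
steps — is *literally* `Literature.Computability.QuantumComplexity.BQTime (fun n => n ^ 2)`
(`BQTime.lean`, the `example … = BQTime (fun n => n ^ 2) := rfl` after the definition), and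
`BQTime (· ^ k) ⊆ BQP` for every `k` (`BQTime_pow_subset_BQP`: an `O(n^k)`-time sigma-encoder is a
polynomial-time uniformity witness). Candidate proof attached to the sibling crux
stmt-QuantumAdvantage-15271 by refuter-rattack-stmt-QuantumAdvantage-15271-0 (`CruxAttack15271.lean`,
`quadSubsetBQP_holds`), landed here verbatim against the route decl.
-/

namespace Summit.QuantumAdvantage.QuantumAdvantage.Theorems

set_option linter.dupNamespace false

/-- **`QuadQ ⊆ BQP`** — closes item stmt-QuantumAdvantage-15275 (`CompactnessLift.QuadSubsetBQP`):
the route's quadratic-time-uniform Clifford+T class is `BQTime (fun n => n ^ 2)` by `rfl`, and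
`BQTime (· ^ 2) ⊆ BQP` is `Literature.Computability.QuantumComplexity.BQTime_pow_subset_BQP 2`
(Bernstein–Vazirani 1997 §8 / Watrous 2009 §IV.1: a time-`O(n²)` description map is in particular a
polynomial-time uniformity witness). -/
theorem quadSubsetBQP_proof :
    Summit.QuantumAdvantage.QuantumAdvantage.Theses.CompactnessLift.QuadSubsetBQP := by
  unfold Summit.QuantumAdvantage.QuantumAdvantage.Theses.CompactnessLift.QuadSubsetBQP
  exact Literature.Computability.QuantumComplexity.BQTime_pow_subset_BQP 2

end Summit.QuantumAdvantage.QuantumAdvantage.Theorems
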